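import Literature.Algebra.Homology.TateNakayamaCupProductInflation
import Literature.Algebra.Homology.CoinducedConjugation
import HarnessLib

/-!
# Milne I Lemma 1.9's engine WITHOUT auxiliary coefficients: every class of `Hⁿ⁺³(G, C)` dies under an
# inflation `Inf_π` with `Inf_π[φ] = d·[φ₁]`, `|G| ∣ d` (Harari Lemma 16.20; Milne ADT I Lemma 1.9)

Topic `Algebra/Homology`; namespace `Literature.Algebra.Homology`.  Theorems only; no definition, no named
fact, no instance, no `sorry`.  Sequel of `TateNakayamaCupProductInflation` (door-c6 g11:
`IsClassModule.map_eq_zero_of_card_dvd` — the statement with coefficients `C ⊗ N`, `N` torsion-free).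

THE POINT.  The colimit arguments for the idèle class formation (`Hʳ(U, C̄) = lim→ Hʳ(H_E, C_E) = 0` for
`r ≥ 3`, the hypothesis `ext_triv_eq_zero_of_three_le` of door-c4's Tate duality theorem) need the vanishing
of the transition maps on `Hⁿ⁺³(G, C)` itself, i.e. the case `N = ℤ` of the engine with the trivial factor
removed: here `Hⁿ⁺³(G, C ⊗ ℤ) → Hⁿ⁺³(G, C)` along the right unitor `ρ : C ⊗ ℤ ≅ C` is onto
(`map_rightUnitor_hom_surjective`), and `Inf_π` commutes with the unitors
(`map_rightUnitor_comp_map`: `ρ_* ≫ Hⁿ(π, ι) = Hⁿ(π, Res(C ⊗ ℤ) → C₁ ⊗ ℤ) ≫ ρ_*`), whence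
**`IsClassModule.map_eq_zero_of_card_dvd_plain`**: for a class module `(G, C, [φ])` (`G` finite), a
homomorphism `π : G₁ → G`, a `G₁`-module `C₁` with a `2`-cocycle `φ₁`, a `G₁`-map `ι : Res_π C → C₁` with
`Inf_π[φ] = d·[φ₁]` and `|G| ∣ d`, the map `Hⁿ⁺³(G, C) → Hⁿ⁺³(G₁, C₁)` along `(π, ι)` is ZERO.

Written for Route A of the Poitou–Tate programme of crux `stmt-BirchSwinnertonDyer-19295` (cell
`bsd-schneider-ideate`, seat door-c6 gen 15).  HONEST FRAMING: finite-group cohomology only.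

## References
* J. S. Milne, *Arithmetic Duality Theorems* (2nd ed. 2006), I §1, Lemma 1.9 (and its proof: the maps of the
  direct system `H^r(G/V, C^V)`, `r ≥ 3`, are eventually zero). [MilneADT2006]
* D. Harari, *Galois Cohomology and Class Field Theory* (2020), §16.3 Lemma 16.20. [Harari2020]
* K. S. Brown, *Cohomology of Groups*, GTM 87 (1982), V §3 (3.4) (unit of the cup product), III §8. [Brown1982CohomologyGroups]
-/

noncomputable section

namespace Literature.Algebra.Homology

open CategoryTheory CategoryTheory.MonoidalCategory groupCohomology

universe u

/-! ## §1 The right unitor on cohomology -/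

section Unitor

variable {k G : Type u} [CommRing k] [Group G] (M : Rep.{u} k G) (n : ℕ)

/-- `ρ_* : Hⁿ(G, M ⊗ k) → Hⁿ(G, M)` (along the right unitor) is onto: `ρ⁻¹_*` is a section.
[cite: Brown1982CohomologyGroups, V §3 (3.4)] -/
theorem map_rightUnitor_hom_surjective :
    Function.Surjective (map (A := M ⊗ Rep.trivial k G k) (MonoidHom.id G) (ρ_ M).hom n) := fun y => by
  refine ⟨map (A := M) (B := M ⊗ Rep.trivial k G k) (MonoidHom.id G) (ρ_ M).inv n y, ?_⟩
  rw [← CategoryTheory.comp_apply, ← map_id_comp, Iso.inv_hom_id]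
  erw [map_id]
  rfl

end Unitor

/-! ## §2 `Inf_π` commutes with the right unitors -/

section Inflation

variable {k : Type u} [CommRing k] {G₁ G₂ : Type u} [Group G₁] [Group G₂] (π : G₁ →* G₂)
  (C₂ : Rep.{u} k G₂) (C₁ : Rep.{u} k G₁) (ι : Rep.res π C₂ ⟶ C₁) (n : ℕ)

/-- Pointwise: `ι(ρ(t)) = ρ((ι ⊗ 1)(t))` for `t ∈ C₂ ⊗ k`. [cite: Brown1982CohomologyGroups, III §8] -/
theorem hom_rightUnitor_eq (t : (C₂ ⊗ Rep.trivial k G₂ k : Rep k G₂).V) :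
    ι.hom ((ρ_ C₂).hom.hom t) =
      (ρ_ C₁).hom.hom ((ι ⊗ₘ 𝟙 (Rep.res π (Rep.trivial k G₂ k))).hom ((resTensorHom C₂ (Rep.trivial k G₂ k) π).hom t)) := by
  rw [Rep.hom_hom_rightUnitor, Rep.hom_hom_rightUnitor, resTensorHom_hom_apply, Rep.hom_tensorHom]
  induction t using TensorProduct.induction_on with
  | zero => simp only [map_zero]
  | tmul c r =>
    -- both sides are `r • ι c` (`rid (w ⊗ a) = a • w`, `(f ⊗ g)(v ⊗ w) = f v ⊗ g w`, definitionally)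
    change ι.hom ((r : k) • c) = (r : k) • ι.hom c
    exact map_smul ι.hom (r : k) c
  | add x y hx hy => simp only [map_add, hx, hy]

/-- **`ρ_* ≫ Hⁿ(π, ι) = Hⁿ(π, Res_π(C₂ ⊗ k) → C₁ ⊗ k) ≫ ρ_*`**: inflation commutes with the right unitors.
[cite: Brown1982CohomologyGroups, III §8] -/
theorem map_rightUnitor_comp_map :
    map (A := C₂ ⊗ Rep.trivial k G₂ k) (MonoidHom.id G₂) (ρ_ C₂).hom n ≫ map π ι n =
      map π (resTensorHom C₂ (Rep.trivial k G₂ k) π ≫ (ι ⊗ₘ 𝟙 (Rep.res π (Rep.trivial k G₂ k)))) n ≫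
        map (A := C₁ ⊗ Rep.res π (Rep.trivial k G₂ k)) (MonoidHom.id G₁) (ρ_ C₁).hom n := by
  rw [← map_comp, ← map_comp]
  exact map_congr' (MonoidHom.ext fun _ => rfl) _ _ (fun t => hom_rightUnitor_eq π C₂ C₁ ι t) n

/-- Elementwise form. [cite: Brown1982CohomologyGroups, III §8] -/
theorem map_map_rightUnitor_apply (y : groupCohomology (C₂ ⊗ Rep.trivial k G₂ k) n) :
    map π ι n (map (A := C₂ ⊗ Rep.trivial k G₂ k) (MonoidHom.id G₂) (ρ_ C₂).hom n y) =
      map (A := C₁ ⊗ Rep.res π (Rep.trivial k G₂ k)) (MonoidHom.id G₁) (ρ_ C₁).hom n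
        (map π (resTensorHom C₂ (Rep.trivial k G₂ k) π ≫ (ι ⊗ₘ 𝟙 (Rep.res π (Rep.trivial k G₂ k)))) n y) := by
  rw [← CategoryTheory.comp_apply, ← CategoryTheory.comp_apply, map_rightUnitor_comp_map]

end Inflation

/-! ## §3 Class modules: every class of `Hⁿ⁺³(G, C)` dies under `Inf_π` -/

section ClassModule

variable {G : Type} [Group G] [Fintype G] {C : Rep.{0} ℤ G} {φ : cocycles₂ C}
variable {G₁ : Type} [Group G₁] (π : G₁ →* G) {C₁ : Rep.{0} ℤ G₁} (ι : Rep.res π C ⟶ C₁)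

/-- **Milne I Lemma 1.9 / Harari Lemma 16.20, finite-layer engine, plain coefficients: EVERY class of
`Hⁿ⁺³(G, C)` dies under an inflation `Inf_π` with `Inf_π[φ] = d·[φ₁]`, `|G| ∣ d`.**  For a class module `C`
of the finite group `G` with fundamental class `[φ]`, a homomorphism `π : G₁ → G`, a `G₁`-module `C₁` with a
`2`-cocycle `φ₁` and a `G₁`-map `ι : Res_π C → C₁` such that `Inf_π[φ] = d·[φ₁]` and `|G| ∣ d`: the map
`Hⁿ⁺³(G, C) → Hⁿ⁺³(G₁, C₁)` along `(π, ι)` vanishes identically (the case `N = ℤ` of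
`IsClassModule.map_eq_zero_of_card_dvd`, the trivial factor removed by the right unitor).
[cite: MilneADT2006, I Lemma 1.9][cite: Harari2020, §16.3 Lemma 16.20] -/
theorem IsClassModule.map_eq_zero_of_card_dvd_plain (hC : IsClassModule C φ) (φ₁ : cocycles₂ C₁) {d : ℕ}
    (hι : map π ι 2 (H2π C φ) = d • H2π C₁ φ₁) (hd : Nat.card G ∣ d) (n : ℕ)
    (y : groupCohomology C (n + 3)) : map π ι (n + 3) y = 0 := by
  obtain ⟨y', rfl⟩ := map_rightUnitor_hom_surjective C (n + 3) y
  rw [map_map_rightUnitor_apply, hC.map_eq_zero_of_card_dvd π ι (Rep.trivial ℤ G ℤ) φ₁ hι hd n y', map_zero]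

end ClassModule

end Literature.Algebra.Homology

end
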